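import Literature.Analysis.FluidPDE.NSVorticityBKM
import Literature.Analysis.FluidPDE.EulerFourierGalerkinLimit
import Literature.Analysis.FluidPDE.TaoH1FourierMildExists
import Literature.Analysis.FluidPDE.TaoH1FourierMildClassical
import Literature.Analysis.FluidPDE.TaoH1FourierDecompositionProofs
import HarnessLib

/-!
# Local existence of smooth solutions of the Euler and Navier–Stokes equations with
# `H³`-controlled lifespan (Majda–Bertozzi 2002, Thm. 3.4 + (3.79)): discharge of
# `MajdaBertozzi2002_localExistenceH3`

Analysis/FluidPDE proof file (theorems only, no definitions, no named facts). It proves the named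
fact `Literature.Analysis.FluidPDE.MajdaBertozzi2002_localExistenceH3` of `NSVorticityBKM.lean`
(A. J. Majda, A. L. Bertozzi, *Vorticity and Incompressible Flow*, CUP 2002, Thm. 3.4 (i)–(ii),
p. 104, with the `H³` a priori bound (3.79) and the remark closing the proof of Thm. 3.6, p. 117):
for `ν ≥ 0` and every `A ≥ 0` there is `τ > 0` such that every smooth divergence-free `u₀` with
`∫‖Dⁿu₀‖² < ∞` for all `n` and `Σ_{n ≤ 3} ∫‖Dⁿu₀‖² ≤ A` launches a classical solution of the
unforced system with viscosity `ν` on `[0, τ] × ℝ³`, equal to `u₀` at `t = 0`, with all Sobolev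
norms bounded on `[0, τ]`.

## The argument

* **The datum on the Fourier side.** By the proved Plancherel fact
  `sobolev_fourierDatum_of_smooth_holds` (`TaoH1FourierDecompositionProofs`), `u₀ = synthVel a = Re 𝓕 a`
  for a Sobolev Fourier datum `a`, which may be taken Borel measurable
  (`IsSobolevFourierDatum.exists_measurable_repr`). Its `H³` Fourier moment is controlled by the
  `H³` norm of `u₀`: `∫⁻ (2π)^{2m}‖ξ‖^{2m}|aₗ|² = Σ_{|α|=m} ∫|∂^α u₀ₗ|² ≤ 3^m ∫‖D^m u₀‖²`
  (`lintegral_weight_enorm_sq_le_of_synthVel`: the tree's weighted Plancherel identity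
  `lintegral_ipderiv_synthVel_sq_eq_of_moments` for the synthesis of a datum with integrable
  polynomial moments — `IsSobolevFourierDatum.integrable_pow_mul_norm` — and
  `|∂^α u₀ₗ| ≤ ‖D^m u₀‖`), whence `∫⁻ (1+‖ξ‖)⁶ Σₗ|aₗ|² ≤ 5376 Σ_{n<4} ∫‖Dⁿu₀‖²`
  (`lintegral_weight_six_sum_enorm_sq_le`; crude constant).
* **`ν = 0` (Euler).** The Fourier–Galerkin construction of this series of files
  (`EulerFourierTransport`, `EulerFourierGalerkin`, `EulerFourierGalerkinEnergy`,
  `EulerFourierGalerkinCauchy`, `EulerFourierGalerkinLimit` — Majda–Bertozzi's §3.2 energy method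
  transposed to the Fourier side with sharp cut-offs) gives a Fourier-side Sobolev-mild solution on
  `[0, τ(5376 A)]` (`exists_isSobolevMild_euler`), the lifespan depending on `A` only.
* **`ν > 0` (Navier–Stokes).** The fact allows a `ν`-dependent lifespan; the tree's proved Picard
  theorem `tao2011_sobolevMild_exists_holds` (Tao 2011, Thm. 5.4 (ii), Fourier side) gives a
  Sobolev-mild solution on `[0, c₀ν³/(A₁+1)²]`, `A₁ = 4π²·5376 A ≥ fourierH1Sq a`
  (`fourierH1Sq_le_weight_six`).
* **Synthesis.** In both cases `u(t) = Re 𝓕 v(t)` with the canonical pressure is a classical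
  solution on the closed slab (`IsSobolevMild.isClassicalNSSolutionOn`, valid for `ν ≥ 0`), with
  all Sobolev norms bounded (`IsSobolevMild.hasBoundedSobolevNormsOn_u`) and `u(0) = synthVel a = u₀`
  (`IsSobolevMild.apply_zero`).

Uniqueness (Thm. 3.4 asserts "the unique solution") is vendored separately
(`MajdaBertozzi2002_uniquenessSobolev`) and is not part of this fact.

## References

* A. J. Majda, A. L. Bertozzi, *Vorticity and Incompressible Flow*, CUP 2002: Thm. 3.4 (i)–(ii)
  with (3.55)–(3.56) (p. 104), §3.2.3–3.2.4 (pp. 105–111), (3.79) and remark p. 117.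
  [MajdaBertozzi2002]
* T. Tao, Localisation and compactness properties of the Navier–Stokes global regularity problem,
  Anal. PDE 6 (2013), Thm. 5.4. [Tao2011]
* E. M. Stein, G. Weiss, *Introduction to Fourier Analysis on Euclidean Spaces*, PUP 1971, Ch. I,
  Thm. 1.8, Thm. 2.3. [SteinWeiss1971]
-/

noncomputable section

open MeasureTheory Real Set Filter Function Metric
open scoped ENNReal NNReal ComplexConjugate FourierTransform ContDiff
open _root_.Topology

namespace Literature.Analysis.FluidPDE

namespace FourierNS

/-- Physical/frequency space `ℝ³`. -/
local notation "ℝ³" => EuclideanSpace ℝ (Fin 3)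

/-! ### Pointwise moments of a Sobolev Fourier datum -/

/-- **Polynomial moments of the components of a Sobolev Fourier datum are integrable**
(`‖ξ‖ᵏ|aₗ| = (1+‖ξ‖)^{k+4}|aₗ| · (1+‖ξ‖)^{-4}`, a product of two `L²` functions). [folklore] -/
theorem IsSobolevFourierDatum.integrable_pow_mul_norm {a : ℝ³ → Fin 3 → ℂ} (ha : IsSobolevFourierDatum a)
    (k : ℕ) (l : Fin 3) : Integrable fun ξ : ℝ³ => ‖ξ‖ ^ k * ‖a ξ l‖ := by
  set K₀ := Fintype.card (Fin 3) + 1 with hK₀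
  have hw : MemLp (fun ξ : ℝ³ => ((1 + ‖ξ‖) ^ K₀)⁻¹) 2 volume := memLp_inv_one_add_norm_pow_two
  have hal : AEStronglyMeasurable (fun ξ => a ξ l) volume := aesm_apply ha.meas l
  -- the weighted component is in `L²`
  have hG : MemLp (fun ξ : ℝ³ => (1 + ‖ξ‖) ^ (k + K₀) * ‖a ξ l‖) 2 volume := by
    have hmeasG : AEStronglyMeasurable (fun ξ : ℝ³ => (1 + ‖ξ‖) ^ (k + K₀) * ‖a ξ l‖) volume :=
      ((continuous_const.add continuous_norm).pow (k + K₀)).aestronglyMeasurable.mul hal.norm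
    refine ⟨hmeasG, ?_⟩
    rw [← lintegral_enorm_sq_rpow_half_eq_eLpNorm]
    refine ENNReal.rpow_lt_top_of_nonneg (by norm_num) (lt_top_iff_ne_top.1 ?_)
    refine lt_of_le_of_lt (lintegral_mono fun ξ => ?_) (ha.moments (k + K₀))
    have e : ‖(1 + ‖ξ‖) ^ (k + K₀) * ‖a ξ l‖‖ₑ = ENNReal.ofReal ((1 + ‖ξ‖) ^ (k + K₀)) * ‖a ξ l‖ₑ := by
      rw [Real.enorm_eq_ofReal (by positivity), ENNReal.ofReal_mul (by positivity), ofReal_norm]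
    rw [e, mul_pow, ← ENNReal.ofReal_pow (by positivity), ← pow_mul, mul_comm (k + K₀) 2]
    gcongr
    exact Finset.single_le_sum (f := fun l => ‖a ξ l‖ₑ ^ 2) (fun _ _ => zero_le) (Finset.mem_univ l)
  refine (hG.integrable_mul hw).mono' ((continuous_norm.pow k).aestronglyMeasurable.mul hal.norm)
    (Eventually.of_forall fun ξ => ?_)
  have hw0 : 0 < (1 + ‖ξ‖) ^ K₀ := by positivity
  rw [Real.norm_of_nonneg (by positivity), Pi.mul_apply]
  have e : (1 + ‖ξ‖) ^ (k + K₀) * ‖a ξ l‖ * ((1 + ‖ξ‖) ^ K₀)⁻¹ = (1 + ‖ξ‖) ^ k * ‖a ξ l‖ := by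
    rw [pow_add]; field_simp
  rw [e]
  gcongr
  linarith [norm_nonneg ξ]

/-- The derivative symbols times a component of a Sobolev Fourier datum are square integrable. [folklore] -/
theorem IsSobolevFourierDatum.memLp_dsym_mul {a : ℝ³ → Fin 3 → ℂ} (ha : IsSobolevFourierDatum a)
    {m : ℕ} (α : Fin m → Fin 3) (l : Fin 3) : MemLp (fun ξ => dsym α ξ * a ξ l) 2 volume := by
  have hal : AEStronglyMeasurable (fun ξ => a ξ l) volume := aesm_apply ha.meas l
  refine memLp_two_of_lintegral_sq_lt_top ((continuous_dsym α).aestronglyMeasurable.mul hal) ?_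
  have hfin := ha.moments m
  have hb : ∫⁻ ξ, ‖dsym α ξ * a ξ l‖ₑ ^ 2 ≤ ENNReal.ofReal ((2 * π) ^ (2 * m)) *
      ∫⁻ ξ, ENNReal.ofReal ((1 + ‖ξ‖) ^ (2 * m)) * ∑ l, ‖a ξ l‖ₑ ^ 2 := by
    rw [← lintegral_const_mul' _ _ ENNReal.ofReal_ne_top]
    refine lintegral_mono fun ξ => ?_
    rw [enorm_mul, mul_pow, ← ofReal_norm (dsym α ξ), ← ENNReal.ofReal_pow (norm_nonneg _), ← mul_assoc,
      ← ENNReal.ofReal_mul (by positivity)]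
    gcongr
    · calc ‖dsym α ξ‖ ^ 2 ≤ ((2 * π * ‖ξ‖) ^ m) ^ 2 := pow_le_pow_left₀ (norm_nonneg _) (norm_dsym_le α ξ) 2
        _ = (2 * π) ^ (2 * m) * ‖ξ‖ ^ (2 * m) := by rw [← pow_mul, mul_comm m 2, mul_pow]
        _ ≤ (2 * π) ^ (2 * m) * (1 + ‖ξ‖) ^ (2 * m) := by gcongr; linarith [norm_nonneg ξ]
    · exact Finset.single_le_sum (f := fun l => ‖a ξ l‖ₑ ^ 2) (fun _ _ => zero_le) (Finset.mem_univ l)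
  exact hb.trans_lt (ENNReal.mul_lt_top ENNReal.ofReal_lt_top hfin)

/-! ### Plancherel bound for the `H³` Fourier moment of the datum -/

/-- **Weighted Plancherel inequality at integer order**: for a measurable Sobolev Fourier datum `a`
whose synthesis `synthVel a = u₀` is smooth with `∫ ‖D^m u₀‖² < ∞` for all `m`,
`∫⁻ (2π)^{2m} ‖ξ‖^{2m} |aₗ(ξ)|² ≤ 3^m ∫⁻ ‖D^m u₀‖²` (Plancherel for the word derivatives,
`|∂^α u₀ₗ| ≤ ‖D^m u₀‖`). [cite: SteinWeiss1971, Ch. I Thm. 2.3 + Thm. 1.8] -/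
theorem lintegral_weight_enorm_sq_le_of_synthVel {a : ℝ³ → Fin 3 → ℂ} (ha : IsSobolevFourierDatum a)
    {u₀ : ℝ³ → ℝ³} (hsm : ContDiff ℝ ∞ u₀) (hsyn : synthVel a = u₀) (m : ℕ) (l : Fin 3) :
    ∫⁻ ξ, ENNReal.ofReal ((2 * π) ^ (2 * m) * ‖ξ‖ ^ (2 * m)) * ‖a ξ l‖ₑ ^ 2 ≤
      3 ^ m * ∫⁻ x, ‖iteratedFDeriv ℝ m u₀ x‖ₑ ^ 2 := by
  have hmeas : ∀ i, AEStronglyMeasurable (fun ξ => a ξ i) volume := fun i => aesm_apply ha.meas i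
  have hmom : ∀ (k : ℕ) (i : Fin 3), Integrable fun ξ : ℝ³ => ‖ξ‖ ^ k * ‖a ξ i‖ :=
    fun k i => ha.integrable_pow_mul_norm k i
  have hg : ContDiff ℝ ∞ fun y => u₀ y l := contDiff_euclidean.1 hsm l
  simp_rw [ofReal_weight_mul_enorm_sq]
  have hm : ∀ α : Fin m → Fin 3, AEMeasurable (fun ξ => ‖dsym α ξ * a ξ l‖ₑ ^ 2) volume := fun α =>
    ((continuous_dsym α).aestronglyMeasurable.mul (hmeas l)).enorm.pow_const 2
  rw [lintegral_finsetSum' _ fun α _ => hm α]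
  calc ∑ α : Fin m → Fin 3, ∫⁻ ξ, ‖dsym α ξ * a ξ l‖ₑ ^ 2
      = ∑ α : Fin m → Fin 3, ∫⁻ x, ENNReal.ofReal (ipderiv α (fun y => synthVel a y l) x ^ 2) :=
        Finset.sum_congr rfl fun α _ => (lintegral_ipderiv_synthVel_sq_eq_of_moments a hmeas hmom
          ha.conjSymm α l (ha.memLp_dsym_mul α l)).symm
    _ ≤ ∑ _α : Fin m → Fin 3, ∫⁻ x, ‖iteratedFDeriv ℝ m u₀ x‖ₑ ^ 2 := by
        refine Finset.sum_le_sum fun α _ => lintegral_mono fun x => ?_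
        rw [hsyn, ← ofReal_norm, ← ENNReal.ofReal_pow (norm_nonneg _), ← sq_abs]
        exact ENNReal.ofReal_le_ofReal (pow_le_pow_left₀ (abs_nonneg _)
          ((abs_ipderiv_le_norm_iteratedFDeriv hg α x).trans (norm_iteratedFDeriv_apply_le hsm l m x)) 2)
    _ = 3 ^ m * ∫⁻ x, ‖iteratedFDeriv ℝ m u₀ x‖ₑ ^ 2 := by simp

/-- **The `H³` Fourier moment of the datum by the `H³` norm of the velocity**:
`∫⁻ (1+‖ξ‖)⁶ ∑ₗ |aₗ|² ≤ 5376 ∑_{n<4} ∫⁻ ‖Dⁿu₀‖²` (crude constant: `(1+t)⁶ ≤ 64(1+t⁶)`,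
`(2π)^{-6} ≤ 1`, `3³ = 27`). [folklore] -/
theorem lintegral_weight_six_sum_enorm_sq_le {a : ℝ³ → Fin 3 → ℂ} (ha : IsSobolevFourierDatum a)
    {u₀ : ℝ³ → ℝ³} (hsm : ContDiff ℝ ∞ u₀) (hsyn : synthVel a = u₀) :
    ∫⁻ ξ, ENNReal.ofReal ((1 + ‖ξ‖) ^ 6) * ∑ l, ‖a ξ l‖ₑ ^ 2 ≤
      5376 * ∑ n ∈ Finset.range 4, ∫⁻ x, ‖iteratedFDeriv ℝ n u₀ x‖ₑ ^ 2 := by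
  have hmeas : ∀ i, AEStronglyMeasurable (fun ξ => a ξ i) volume := fun i => aesm_apply ha.meas i
  set D : ℕ → ℝ≥0∞ := fun n => ∫⁻ x, ‖iteratedFDeriv ℝ n u₀ x‖ₑ ^ 2 with hD
  -- orders 0 and 3 for each component
  have h0 : ∀ l, ∫⁻ ξ, ‖a ξ l‖ₑ ^ 2 ≤ D 0 := fun l => by
    have h := lintegral_weight_enorm_sq_le_of_synthVel ha hsm hsyn 0 l
    simpa using h
  have h3 : ∀ l, ∫⁻ ξ, ENNReal.ofReal (‖ξ‖ ^ 6) * ‖a ξ l‖ₑ ^ 2 ≤ 27 * D 3 := fun l => by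
    have h := lintegral_weight_enorm_sq_le_of_synthVel ha hsm hsyn 3 l
    have hπ : (1 : ℝ) ≤ (2 * π) ^ (2 * 3) := one_le_pow₀ (by linarith [Real.pi_gt_three])
    refine le_trans (lintegral_mono fun ξ => ?_) (h.trans (le_of_eq (by norm_num [hD])))
    gcongr
    calc ‖ξ‖ ^ 6 = 1 * ‖ξ‖ ^ (2 * 3) := by norm_num
      _ ≤ (2 * π) ^ (2 * 3) * ‖ξ‖ ^ (2 * 3) := by gcongr
  -- pointwise weight bound `(1+t)^6 ≤ 64 (1 + t^6)`
  have hw : ∀ ξ : ℝ³, ENNReal.ofReal ((1 + ‖ξ‖) ^ 6) ≤ 64 * (1 + ENNReal.ofReal (‖ξ‖ ^ 6)) := fun ξ => by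
    have h := one_add_pow_two_mul_le (norm_nonneg ξ) 3
    norm_num at h
    calc ENNReal.ofReal ((1 + ‖ξ‖) ^ 6) ≤ ENNReal.ofReal (64 * (1 + ‖ξ‖ ^ 6)) := ENNReal.ofReal_le_ofReal h
      _ = 64 * (1 + ENNReal.ofReal (‖ξ‖ ^ 6)) := by
          rw [ENNReal.ofReal_mul (by norm_num), ENNReal.ofReal_add (by norm_num) (by positivity),
            ENNReal.ofReal_one, show (64 : ℝ) = ((64 : ℕ) : ℝ) by norm_num, ENNReal.ofReal_natCast]
          norm_num
  have hmeas2 : ∀ l, AEMeasurable (fun ξ => ‖a ξ l‖ₑ ^ 2) volume := fun l => (hmeas l).enorm.pow_const 2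
  have hn6 : Measurable fun ξ : ℝ³ => ENNReal.ofReal (‖ξ‖ ^ 6) := (continuous_norm.pow 6).measurable.ennreal_ofReal
  calc ∫⁻ ξ, ENNReal.ofReal ((1 + ‖ξ‖) ^ 6) * ∑ l, ‖a ξ l‖ₑ ^ 2
      ≤ ∫⁻ ξ, 64 * (1 + ENNReal.ofReal (‖ξ‖ ^ 6)) * ∑ l, ‖a ξ l‖ₑ ^ 2 :=
        lintegral_mono fun ξ => mul_le_mul_left (hw ξ) _
    _ = 64 * ∑ l, ((∫⁻ ξ, ‖a ξ l‖ₑ ^ 2) + ∫⁻ ξ, ENNReal.ofReal (‖ξ‖ ^ 6) * ‖a ξ l‖ₑ ^ 2) := by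
        have e : ∀ ξ : ℝ³, 64 * (1 + ENNReal.ofReal (‖ξ‖ ^ 6)) * ∑ l, ‖a ξ l‖ₑ ^ 2 =
            64 * ∑ l, (‖a ξ l‖ₑ ^ 2 + ENNReal.ofReal (‖ξ‖ ^ 6) * ‖a ξ l‖ₑ ^ 2) := fun ξ => by
          rw [mul_assoc, Finset.mul_sum]
          congr 1
          exact Finset.sum_congr rfl fun l _ => by ring
        simp_rw [e]
        rw [lintegral_const_mul' _ _ (by norm_num)]
        congr 1
        rw [lintegral_finsetSum' (f := fun l ξ => ‖a ξ l‖ₑ ^ 2 + ENNReal.ofReal (‖ξ‖ ^ 6) * ‖a ξ l‖ₑ ^ 2) _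
          fun l _ => (hmeas2 l).add (hn6.aemeasurable.mul (hmeas2 l))]
        refine Finset.sum_congr rfl fun l _ => ?_
        exact lintegral_add_left' (hmeas2 l) _
    _ ≤ 64 * ∑ _l : Fin 3, (D 0 + 27 * D 3) := by
        gcongr with l _
        · exact h0 l
        · exact h3 l
    _ = 192 * D 0 + 5184 * D 3 := by simp; ring
    _ ≤ 5376 * D 0 + 5376 * D 3 := by gcongr <;> norm_num
    _ ≤ 5376 * ∑ n ∈ Finset.range 4, D n := by
        rw [← mul_add]
        gcongr
        rw [Finset.sum_range_succ, Finset.sum_range_succ, Finset.sum_range_succ, Finset.sum_range_one]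
        calc D 0 + D 3 = D 0 + 0 + 0 + D 3 := by ring
          _ ≤ D 0 + D 1 + D 2 + D 3 := by gcongr <;> exact zero_le

end FourierNS

open FourierNS

/-! ### The assembly -/

/-- The crude constant of the `H³` Plancherel bound, as a real number: `A₆ = 5376 A`. [folklore] -/
theorem lintegral_weight_six_le_const {a : EuclideanSpace ℝ (Fin 3) → Fin 3 → ℂ} (ha : IsSobolevFourierDatum a)
    {u₀ : EuclideanSpace ℝ (Fin 3) → EuclideanSpace ℝ (Fin 3)} (hsm : ContDiff ℝ ∞ u₀) (hsyn : synthVel a = u₀)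
    {A : ℝ≥0} (hA : (∑ n ∈ Finset.range 4, ∫⁻ x, ‖iteratedFDeriv ℝ n u₀ x‖ₑ ^ 2) ≤ (A : ℝ≥0∞)) :
    ∫⁻ ξ, ENNReal.ofReal ((1 + ‖ξ‖) ^ 6) * ∑ l, ‖a ξ l‖ₑ ^ 2 ≤ ENNReal.ofReal (5376 * (A : ℝ)) := by
  refine (lintegral_weight_six_sum_enorm_sq_le ha hsm hsyn).trans ?_
  rw [ENNReal.ofReal_mul (by norm_num), ENNReal.ofReal_coe_nnreal,
    show (5376 : ℝ≥0∞) = ENNReal.ofReal 5376 by norm_num]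
  exact mul_le_mul_right hA _

/-- The Fourier `H¹` quantity by the `H³` Fourier moment: `fourierH1Sq a ≤ 4π² ∫⁻ (1+‖ξ‖)⁶ ∑|aₗ|²`. [folklore] -/
theorem fourierH1Sq_le_weight_six (a : EuclideanSpace ℝ (Fin 3) → Fin 3 → ℂ) :
    fourierH1Sq a ≤ ENNReal.ofReal (4 * π ^ 2) * ∫⁻ ξ, ENNReal.ofReal ((1 + ‖ξ‖) ^ 6) * ∑ l, ‖a ξ l‖ₑ ^ 2 := by
  rw [fourierH1Sq, ← lintegral_const_mul' _ _ ENNReal.ofReal_ne_top]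
  refine lintegral_mono fun ξ => ?_
  rw [← mul_assoc, ← ENNReal.ofReal_mul (by positivity)]
  gcongr
  have h0 := norm_nonneg ξ
  have hπ : (1 : ℝ) ≤ 4 * π ^ 2 := by nlinarith [Real.pi_gt_three]
  have h1 : (1 + ‖ξ‖) ^ 2 ≤ (1 + ‖ξ‖) ^ 6 := pow_le_pow_right₀ (by linarith) (by norm_num)
  nlinarith [h1, sq_nonneg ‖ξ‖, mul_nonneg (sub_nonneg.2 hπ) (sq_nonneg ‖ξ‖)]

/-- **Discharge of `MajdaBertozzi2002_localExistenceH3`** (Majda–Bertozzi 2002, Thm. 3.4 with the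
`H³`-controlled lifespan of (3.79)/Thm. 3.6, in the `H^∞ ∩ C^∞` rendering of the fact). For
`ν = 0` the solution is the synthesis of the Fourier–Galerkin limit of this series of files
(`exists_isSobolevMild_euler`, lifespan `τ(5376 A)` depending on `A` only); for `ν > 0` it is the
synthesis of the Fourier-side Picard solution of the tree (`tao2011_sobolevMild_exists_holds`,
lifespan `c₀ν³/(A₁+1)²`, `A₁ = 4π²·5376 A`; the fact allows a `ν`-dependent lifespan). In both
cases the datum is the measurable Sobolev Fourier datum of `u₀` given by Plancherel
(`sobolev_fourierDatum_of_smooth_holds`, `IsSobolevFourierDatum.exists_measurable_repr`), its `H³`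
Fourier moment is bounded by the `H³` norm of `u₀` (`lintegral_weight_six_sum_enorm_sq_le`), and the
synthesis `u(t) = Re 𝓕 v(t)` is a classical solution with all Sobolev norms bounded
(`IsSobolevMild.isClassicalNSSolutionOn`, `IsSobolevMild.hasBoundedSobolevNormsOn_u`).
[cite: MajdaBertozzi2002, Thm. 3.4 (i)-(ii) (p. 104), (3.79) and remark p. 117] -/
theorem MajdaBertozzi2002_localExistenceH3_holds : MajdaBertozzi2002_localExistenceH3 := by
  intro ν hν A
  obtain ⟨c₀, hc₀, hPic⟩ := tao2011_sobolevMild_exists_holds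
  have hA6 : (0 : ℝ) ≤ 5376 * (A : ℝ) := by positivity
  rcases hν.eq_or_lt with h0 | hpos
  · -- the Euler equations: the Fourier–Galerkin limit
    subst h0
    refine ⟨lifespan (5376 * (A : ℝ)), lifespan_pos hA6, ?_⟩
    intro u₀ hsm hdiv hH hA
    obtain ⟨a, ha, hsyn, -⟩ := sobolev_fourierDatum_of_smooth_holds hsm hdiv hH
    obtain ⟨a', -, ha', -, hsyn', -⟩ := ha.exists_measurable_repr
    have hsynu : synthVel a' = u₀ := hsyn'.trans hsyn
    have hM := lintegral_weight_six_le_const ha' hsm hsynu hA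
    obtain ⟨w, hw⟩ := exists_isSobolevMild_euler ha' hA6 hM
    have hτ := lifespan_pos hA6
    have hw' : IsSobolevMild (4 * π ^ 2 * (0 : ℝ)) (lifespan (5376 * (A : ℝ))) a' w := by
      rw [mul_zero]; exact hw
    refine ⟨fun t => synthVel (w t), _, hw'.isClassicalNSSolutionOn le_rfl hτ ha', ?_,
      hw.hasBoundedSobolevNormsOn_u le_rfl ha' _⟩
    have h0 : w 0 = a' := funext fun ξ => hw.apply_zero hτ.le ξ
    show synthVel (w 0) = u₀
    rw [h0, hsynu]
  · -- the Navier–Stokes equations: the Fourier-side Picard solution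
    set A₁ : ℝ := 4 * π ^ 2 * (5376 * (A : ℝ)) with hA₁
    have hA₁0 : 0 ≤ A₁ := by positivity
    set T : ℝ := c₀ * ν ^ 3 / (A₁ + 1) ^ 2 with hT
    have hTpos : 0 < T := by positivity
    refine ⟨T, hTpos, ?_⟩
    intro u₀ hsm hdiv hH hA
    obtain ⟨a, ha, hsyn, -⟩ := sobolev_fourierDatum_of_smooth_holds hsm hdiv hH
    obtain ⟨a', ha'm, ha', -, hsyn', -⟩ := ha.exists_measurable_repr
    have hsynu : synthVel a' = u₀ := hsyn'.trans hsyn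
    have hM := lintegral_weight_six_le_const ha' hsm hsynu hA
    have hH1 : fourierH1Sq a' ≤ ENNReal.ofReal A₁ := by
      refine (fourierH1Sq_le_weight_six a').trans ?_
      rw [hA₁, ENNReal.ofReal_mul (p := 4 * π ^ 2) (by positivity)]
      exact mul_le_mul_right hM _
    have hsmall : A₁ ^ 2 * T ≤ c₀ * ν ^ 3 := by
      rw [hT, ← mul_div_assoc, div_le_iff₀ (by positivity)]
      have h1 : A₁ ^ 2 ≤ (A₁ + 1) ^ 2 := by gcongr; linarith
      nlinarith [h1, mul_pos hc₀ (pow_pos hpos 3)]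
    obtain ⟨w, hw⟩ := hPic hpos hTpos ha' ha'm hA₁0 hH1 hsmall
    refine ⟨fun t => synthVel (w t), _, hw.isClassicalNSSolutionOn hν hTpos ha', ?_,
      hw.hasBoundedSobolevNormsOn_u (by positivity) ha' _⟩
    have h0 : w 0 = a' := funext fun ξ => hw.apply_zero hTpos.le ξ
    show synthVel (w 0) = u₀
    rw [h0, hsynu]

end Literature.Analysis.FluidPDE

end
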